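import Summits.BirchSwinnertonDyer.BirchSwinnertonDyer.Theorems.KolyvaginRoadThreeMethod2KolyvaginPerfLocal
import Summits.BirchSwinnertonDyer.BirchSwinnertonDyer.Theorems.KolyvaginRoadThreeMethod2KolyvaginPerfCore
import Summits.BirchSwinnertonDyer.BirchSwinnertonDyer.Theorems.KolyvaginRoadThreeMethod2KolyvaginLocalGross
import Summits.BirchSwinnertonDyer.BirchSwinnertonDyer.Theorems.KolyvaginRoadThreeMethod2LocalFrobenius
import Summits.BirchSwinnertonDyer.BirchSwinnertonDyer.Theorems.KolyvaginRoadThreeMethod2LocalDictionaries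
import Literature.NumberTheory.EllipticCurves.HeegnerPointsKolyvaginProp81InertiaProofs
import Literature.NumberTheory.GaloisCohomology.PoitouTateSumTotallyComplex
import HarnessLib

/-!
# KOLY method line, crux stmt-BirchSwinnertonDyer-19574 `ZhangSharpFrameAtThreeHL`, stub S2-ENGINE: (Perf) — THE LOCAL
# WEIL CUP PRODUCT PAIRS THE UNRAMIFIED AND THE TRANSVERSE EIGEN-LINES AT A KOLYVAGIN PRIME NON-DEGENERATELY
# (cell `bsd-stepL`, seat `bsd-stepL-zhang3-p1` g9; `--supports 19574`, helper; discharges the binder `hperf` of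
# `Method2.triangulation_of_kolyvaginLocal`, p508963, per Kolyvagin prime)

W. Zhang 2014, Lemma 8.4 (1)/(3) with Gross 1991, Prop. 8.1–8.2: at a Kolyvagin prime `λ` of the Hoffstein–Luo frame,
for `c`-eigenclasses `x, y ∈ H¹(K, E[3])^{s}` with `x` Selmer (unramified) at `λ`, `loc_λ x ≠ 0`, `y` transverse at `λ`,
`loc_λ y ≠ 0`, the local Weil cup product `loc_λ x ∪ₑ loc_λ y ∈ H²(K_λ, μ₃)` is NON-ZERO, for every Weil-type pairing `e`.

Proof (structural — no evaluation formula (7.6) is needed). `Γ_λ = Γ_{K_λ}` acts trivially on `E[3]` (`G_𝔓 ≤ Γ_{K(E[3])}`,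
`KolyLocal.decompositionSubgroup_le_torsionFixing`) and on `μ₃` (`smul_eq_self_of_pow_three_eq_one_of_mem_torsionFixing`), so
local `1`-cocycles are homomorphisms and cup-product cocycles are `(σ, τ) ↦ ⟨f σ, g τ⟩`. The cocycle `f_x` of `loc x` is
`σ ↦ k_σ P`, `P = [x, F] ∈ E[3]^{s} ∖ 0` (Gross's Frobenius lift `F`, Prop. 9.6, `exists_apply_eq_nsmul_apply_of_unramified`);
hence `loc x ∪ₑ loc y` has cocycle `k_σ · n(τ)`, `n = ẽ(P, f_y(·))`, and for ANY class `η' ∈ H¹(K_λ, E[3]^D)` the local Tate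
cocycle of `(loc x, η')` is `k_σ · m(τ)`, `m = g'(·)(P)`. By local Tate duality (the perfect Poitou–Tate family of the tree,
`IsPerfect`) some `η'` has `[k_σ m(τ)] ≠ 0`. The characters `n, m : Γ_λ → μ₃` satisfy `m = j·n + t·ᾱ` pointwise
(`Γ_λ = ⟨g_F⟩ · I · U` with SIMULTANEOUS tame factorisation of `(n, m)` on the inertia group,
`InertiaTame.exists_forall_apply_eq_nsmul`; here `n` is ramified: `[y, i] ∈ E[3]^{-s} ∖ 0` for some `i ∈ I_𝔓` by
transversality + `G_𝔓 = I_𝔓 (G_𝔓 ∩ Stab K[ℓ])` + Gross Prop. 8.1 (1), and `e(P, [y, i]) ≠ 1`, `weil_ne_one_of_eigen`), so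
`[k_σ m] = j [k_σ n] + [k_σ k_τ w₀]` and the last class vanishes (symmetric, `twoCocycleClass_eq_zero_of_symmetric`).
Hence `[loc x ∪ₑ loc y] = [k_σ n] ≠ 0`.
-/

noncomputable section

open scoped Classical Pointwise

namespace Summit.BirchSwinnertonDyer.Rank1Residual.X11b.Three.Koly.Method2.KolyLocal

open CategoryTheory WeierstrassCurve Field Function NumberField IsDedekindDomain
open Literature.NumberTheory.EllipticCurves Literature.NumberTheory.EllipticCurves.ModularForms
  Literature.NumberTheory.GaloisRepresentations Module
open Literature.NumberTheory.GaloisRepresentations.DiscreteGaloisModule (mu MuCarrier tateDual tateDualEval TateDual)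
open Literature.NumberTheory.GaloisCohomology
open Summit.BirchSwinnertonDyer.Rank1Residual.X11b.Three.Koly.Method2
open Summit.BirchSwinnertonDyer.Rank1Residual.GaloisImage
open scoped ContRepresentation

attribute [local instance] absoluteGaloisGroup_compactSpace
attribute [local instance] finite_geomTorsion_of_neZero

variable (W : WeierstrassCurve ℚ) (K : Type) [Field K] [NumberField K] [W.IsElliptic] [W.IsGloballyMinimal]

/-- **The ramified value at a Kolyvagin prime** (Gross 1991, Prop. 8.1 (1)–(2) + Prop. 9.6, for the classes of (Perf)):
for `x ∈ H¹(K, E[3])^{s}` Selmer at `λ` with `loc_λ x ≠ 0` and `y ∈ H¹(K, E[3])^{s}` transverse at `λ` with `loc_λ y ≠ 0`,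
there are an arithmetic Frobenius `F ∈ Γ_{K(E[3])}` at the prime `𝔓 ∣ λ` cut out by the chosen embedding and an inertia
element `i ∈ I_𝔓` with `P = [x, F] ≠ 0` and `e(P, [y, i]) ≠ 1` (additively: `≠ 0` in `μ₃`). Proof: Gross's Frobenius lift
(`exists_frobeniusLift_of_isKolyvaginPrime`, through the bridge `isKolyvaginPrime_three_of_zhang`); `P ≠ 0` by Prop. 9.6;
`P ∈ E[3]^{s}`; `y ∉ torsionLocalKer` gives `d ∈ G_𝔓` with `[y, d] ≠ 0`, `G_𝔓 = I_𝔓 (G_𝔓 ∩ Stab K[ℓ])` and transversality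
give `i ∈ I_𝔓` with `[y, i] ≠ 0`, `[y, i] ∈ E[3]^{-s}` (Prop. 8.1 (1)), and opposite eigenvectors pair non-trivially.
[cite: GrossLMS1991, Prop. 8.1, Prop. 8.2 (proof), Prop. 9.6] [cite: WZhang2014, §8.1] -/
theorem exists_frob_inertia_weil_ne_zero (hK : IsImaginaryQuadratic K) (hsurj : W.HasSurjectiveModNGaloisRep 3)
    (ι : K →+* ℂ) {c : K ≃ₐ[ℚ] K} (hc : c ≠ 1)
    (e : geomTorsion (W.baseChange K) ((3 ^ 1 : ℕ) : ℤ) → geomTorsion (W.baseChange K) ((3 ^ 1 : ℕ) : ℤ) →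
      AlgebraicClosure K)
    (hμ : ∀ P Q, e P Q ^ (3 ^ 1) = 1) (hadd₁ : ∀ P₁ P₂ Q, e (P₁ + P₂) Q = e P₁ Q * e P₂ Q)
    (hadd₂ : ∀ P Q₁ Q₂, e P (Q₁ + Q₂) = e P Q₁ * e P Q₂) (halt : ∀ Q, e Q Q = 1)
    (hnondeg : ∀ Q, (∀ P, e P Q = 1) → Q = 0)
    {ℓ : ℕ} (hℓ : Zhang2014.IsKolyvaginPrime (W.conductorNorm ℤ) W K 3 ℓ) (v : HeightOneSpectrum (𝓞 K))
    (hv : (ℓ : 𝓞 K) ∈ v.asIdeal) {𝔐 : Ideal (HeightOneSpectrum.localAbsIntegers v)} (h𝔐 : 𝔐 ∈ v.localPrimesAbove)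
    (s : Bool) {x y : V3 W K}
    (hxs : conjAct W c ((3 ^ 1 : ℕ) : ℤ) x = sgn s • x) (hys : conjAct W c ((3 ^ 1 : ℕ) : ℤ) y = sgn s • y)
    (hxK : x ∈ selmerLocalKer (W.baseChange K) (v.adicCompletion K) ((3 ^ 1 : ℕ) : ℤ))
    (hx0 : x ∉ (W.baseChange K).torsionLocalKer (v.adicCompletion K) ((3 ^ 1 : ℕ) : ℤ))
    (hyT : y ∈ transverseLocalKer W K ι ℓ v)
    (hy0 : y ∉ (W.baseChange K).torsionLocalKer (v.adicCompletion K) ((3 ^ 1 : ℕ) : ℤ)) :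
    ∃ F i : absoluteGaloisGroup K,
      IsArithFrobAt (𝓞 K) F (v.primeBelow (closureEmb (K := K) (v.adicCompletion K)) 𝔐) ∧
      F ∈ torsionFixing (W.baseChange K) ((3 ^ 1 : ℕ) : ℤ) ∧
      i ∈ (v.primeBelow (closureEmb (K := K) (v.adicCompletion K)) 𝔐).inertia (absoluteGaloisGroup K) ∧
      h1Eval (W.baseChange K) ((3 ^ 1 : ℕ) : ℤ) x F ≠ 0 ∧
      weilPairingHom (W.baseChange K) (3 ^ 1) e hμ hadd₁ hadd₂ (h1Eval (W.baseChange K) ((3 ^ 1 : ℕ) : ℤ) x F)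
        (h1Eval (W.baseChange K) ((3 ^ 1 : ℕ) : ℤ) y i) ≠ 0 := by
  classical
  haveI : NeZero (3 ^ 1 : ℕ) := ⟨by norm_num⟩
  -- ### the Kolyvagin prime in Gross's sense (at level `3 ^ 1`); `v = λ`; good reduction, `3 ∉ λ`
  have hℓG : IsKolyvaginPrime (W.conductorNorm ℤ) W K (3 ^ 1) ℓ := isKolyvaginPrime_three_of_zhang W K hK hsurj hℓ
  have hvw : v = hℓG.place := hℓG.mem_iff.mp hv
  subst hvw
  obtain ⟨hgood, h3v⟩ := hasGoodReductionAt_of_kolyvagin W K hℓ hℓG.place hv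
  have hvbad : hℓG.place ∉ (W.baseChange K).badPlaces (𝓞 K) := fun h ↦ h hgood
  haveI : CharZero (hℓG.place.adicCompletion K) :=
    charZero_of_injective_algebraMap (algebraMap K (hℓG.place.adicCompletion K)).injective
  set Kv := hℓG.place.adicCompletion K with hKv
  have h𝔓 : hℓG.place.primeBelow (closureEmb (K := K) Kv) 𝔐 ∈ hℓG.place.primesAbove :=
    HeightOneSpectrum.primeBelow_mem_primesAbove h𝔐
  -- ### Gross's Frobenius lift at `𝔓`
  obtain ⟨h, c₀, F, ht, -, -, hμinv, hFrob, hF, -, hFT, hcF, -, -, -, -⟩ :=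
    exists_frobeniusLift_of_isKolyvaginPrime W hK (p := 3 ^ 1) (by norm_num) (by norm_num) hc hℓG h𝔓
  have hI : (hℓG.place.primeBelow (closureEmb (K := K) Kv) 𝔐).inertia (absoluteGaloisGroup K) ≤
      torsionFixing (W.baseChange K) ((3 ^ 1 : ℕ) : ℤ) := inertia_le_torsionFixing (W.baseChange K) hvbad h3v _ h𝔐
  have hD : ∀ d ∈ (hℓG.place.primeBelow (closureEmb (K := K) Kv) 𝔐).decompositionSubgroup (absoluteGaloisGroup K),
      d ∈ torsionFixing (W.baseChange K) ((3 ^ 1 : ℕ) : ℤ) := fun d hd ↦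
    decompositionSubgroup_le_torsionFixing W K hK hℓ hℓG.place hv h𝔐 hd
  -- ### `P = [x, F] ∈ E[3]^{s} ∖ 0`
  have hxunr : x ∈ unramifiedKer (geomTorsion (W.baseChange K) ((3 ^ 1 : ℕ) : ℤ))
      (hℓG.place.primeBelow (closureEmb (K := K) Kv) 𝔐) := by
    rw [← (W.baseChange K).selmerLocalKer_eq_unramifiedKer hgood h3v h𝔓]; exact hxK
  have hP0 : h1Eval (W.baseChange K) ((3 ^ 1 : ℕ) : ℤ) x F ≠ 0 := fun h0 ↦ hx0
    ((mem_torsionLocalKer_iff_h1Eval_eq_zero (W.baseChange K) ((3 ^ 1 : ℕ) : ℤ) h𝔐 hF hFT hI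
      (isOpen_torsionFixing (W.baseChange K) (by norm_num))
      (torsionPointsMap_bijective (W.baseChange K) Kv (n := 3 ^ 1) (by norm_num)).2 hxunr).mpr h0)
  have hPs : ht.torsionMap W ((3 ^ 1 : ℕ) : ℤ) (h1Eval (W.baseChange K) ((3 ^ 1 : ℕ) : ℤ) x F) =
      sgn s • h1Eval (W.baseChange K) ((3 ^ 1 : ℕ) : ℤ) x F := torsionMap_h1Eval_eq_of_conjAct_eq W ht _ hFT hcF hxs
  have hν : sgn s = 1 ∨ sgn s = -1 := by cases s <;> simp [sgn]
  -- ### a decomposition element, then an inertia element, with non-zero `y`-value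
  set φy := reprCocycle (W.baseChange K) ((3 ^ 1 : ℕ) : ℤ) y with hφy
  have hyD : ∃ d ∈ (hℓG.place.primeBelow (closureEmb (K := K) Kv) 𝔐).decompositionSubgroup (absoluteGaloisGroup K),
      φy.1 d ≠ 0 := by
    by_contra hall
    push Not at hall
    apply hy0
    rw [← oneCocycleClass_reprCocycle (W.baseChange K) ((3 ^ 1 : ℕ) : ℤ) y]
    exact (LocalFrob.oneCocycleClass_mem_torsionLocalKer_iff (W.baseChange K) (v := hℓG.place) (n := 3 ^ 1)
      (by norm_num) h𝔐 φy).mpr ⟨0, fun d hd ↦ by rw [hall d hd, smul_zero, sub_zero]⟩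
  obtain ⟨d, hdD, hd0⟩ := hyD
  obtain ⟨i, hiI, hi'⟩ := exists_inertia_inv_mul_mem_ringClassStabilizer W K hK ι hℓ hℓG.place hv
    (fun v' ↦ hℓG.mem_iff) h𝔓 hdD
  have hiD : i ∈ (hℓG.place.primeBelow (closureEmb (K := K) Kv) 𝔐).decompositionSubgroup (absoluteGaloisGroup K) :=
    Ideal.inertia_le_stabilizer _ hiI
  have hQ0 : φy.1 i ≠ 0 := by
    intro h0
    apply hd0
    have hd' : i⁻¹ * d ∈ (hℓG.place.primeBelow (closureEmb (K := K) Kv) 𝔐).decompositionSubgroup (absoluteGaloisGroup K) :=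
      Subgroup.mul_mem _ (Subgroup.inv_mem _ hiD) hdD
    have htr : φy.1 (i⁻¹ * d) = 0 := (mem_transverseLocalKer_iff.mp hyT) _ h𝔓 _ hd' hi' (hD _ hd')
    have hsplit := φy.2 i (i⁻¹ * d)
    rw [mul_inv_cancel_left] at hsplit
    rw [hsplit, htr, map_zero, add_zero]
    exact h0
  -- `[y, i] ∈ E[3]^{-s}` (Gross Prop. 8.1 (1)), hence `e(P, [y, i]) ≠ 1`
  have hQs : ht.torsionMap W ((3 ^ 1 : ℕ) : ℤ) (φy.1 i) = -(sgn s • φy.1 i) :=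
    torsionMap_h1Eval_inertia_eq_neg W (p := 3 ^ 1) (by norm_num) hℓG hvbad h𝔓 ht hFrob hμinv hys hiI
  have hePQ : e (h1Eval (W.baseChange K) ((3 ^ 1 : ℕ) : ℤ) x F) (φy.1 i) ≠ 1 :=
    weil_ne_one_of_eigen W K e hμ hadd₁ hadd₂ halt hnondeg (ht.torsionMap W _) hν hPs hP0 hQs hQ0
  refine ⟨F, i, hF, hFT, hiI, hP0, fun h0 ↦ hePQ ?_⟩
  rw [muCarrier_eq_iff, coe_weilPairingHom] at h0
  exact h0

set_option maxHeartbeats 400000 in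
/-- **(Perf) at a Kolyvagin prime of the HL frame** — binder `hperf` of `Method2.triangulation_of_kolyvaginLocal`, per prime
and per place `v ∋ ℓ`: for every Weil-type pairing `e` on `E[3]` and each sign `s`, the local Weil cup product of the
`λ`-localisations of `x ∈ H¹(K, E[3])^{s}` Selmer at `λ` with `loc_λ x ≠ 0` and `y ∈ H¹(K, E[3])^{s}` transverse at `λ` with
`loc_λ y ≠ 0` is non-zero. See the module docstring for the (structural) proof.
[cite: WZhang2014, Lemma 8.4 (1), (3), §8.1] [cite: GrossLMS1991, Prop. 8.1, Prop. 8.2, Prop. 9.6]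
[cite: MilneADT2006, Ch. I, Cor. 2.3] -/
theorem cupProduct_ne_zero_of_selmer_of_transverse (hK : IsImaginaryQuadratic K) (hsurj : W.HasSurjectiveModNGaloisRep 3)
    (ι : K →+* ℂ) {c : K ≃ₐ[ℚ] K} (hc : c ≠ 1)
    (e : geomTorsion (W.baseChange K) ((3 ^ 1 : ℕ) : ℤ) → geomTorsion (W.baseChange K) ((3 ^ 1 : ℕ) : ℤ) →
      AlgebraicClosure K)
    (hμ : ∀ P Q, e P Q ^ (3 ^ 1) = 1) (hadd₁ : ∀ P₁ P₂ Q, e (P₁ + P₂) Q = e P₁ Q * e P₂ Q)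
    (hadd₂ : ∀ P Q₁ Q₂, e P (Q₁ + Q₂) = e P Q₁ * e P Q₂) (halt : ∀ Q, e Q Q = 1)
    (hnondeg : ∀ Q, (∀ P, e P Q = 1) → Q = 0)
    (hgal : ∀ (σ : absoluteGaloisGroup K) (P Q : geomTorsion (W.baseChange K) ((3 ^ 1 : ℕ) : ℤ)),
      σ • e P Q = e (σ • P) (σ • Q))
    {ℓ : ℕ} (hℓ : Zhang2014.IsKolyvaginPrime (W.conductorNorm ℤ) W K 3 ℓ) (v : HeightOneSpectrum (𝓞 K))
    (hv : (ℓ : 𝓞 K) ∈ v.asIdeal) (s : Bool) {x y : V3 W K}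
    (hxs : conjAct W c ((3 ^ 1 : ℕ) : ℤ) x = sgn s • x) (hys : conjAct W c ((3 ^ 1 : ℕ) : ℤ) y = sgn s • y)
    (hxK : x ∈ selmerLocalKer (W.baseChange K) (v.adicCompletion K) ((3 ^ 1 : ℕ) : ℤ))
    (hx0 : x ∉ (W.baseChange K).torsionLocalKer (v.adicCompletion K) ((3 ^ 1 : ℕ) : ℤ))
    (hyT : y ∈ transverseLocalKer W K ι ℓ v)
    (hy0 : y ∉ (W.baseChange K).torsionLocalKer (v.adicCompletion K) ((3 ^ 1 : ℕ) : ℤ)) :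
    (weilContPairingLocal (W.baseChange K) (3 ^ 1) e hμ hadd₁ hadd₂ hgal (Sum.inr v)).cupProduct
      (galoisCohomology.localization ((W.baseChange K).torsionGaloisModule ((3 ^ 1 : ℕ) : ℤ)) (Sum.inr v) 1 x)
      (galoisCohomology.localization ((W.baseChange K).torsionGaloisModule ((3 ^ 1 : ℕ) : ℤ)) (Sum.inr v) 1 y) ≠ 0 := by
  classical
  haveI : NeZero (3 ^ 1 : ℕ) := ⟨by norm_num⟩
  haveI : IsTotallyComplex K := hK.2
  -- the perfect Poitou–Tate family of the tree (local Tate duality at `λ`)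
  obtain ⟨inv, hinvperf, -⟩ := poitouTate_sum_localTatePairing_eq_zero_of_isTotallyComplex K (3 ^ 1)
  -- ### the Kolyvagin prime in Gross's sense; `v = λ`; `3 ∉ λ`
  have hℓG := isKolyvaginPrime_three_of_zhang W K hK hsurj hℓ
  have hvw : v = hℓG.place := hℓG.mem_iff.mp hv
  subst hvw
  obtain ⟨hgood, h3v⟩ := hasGoodReductionAt_of_kolyvagin W K hℓ hℓG.place hv
  obtain ⟨𝔐, h𝔐⟩ := hℓG.place.localPrimesAbove_nonempty
  have h𝔓 : hℓG.place.primeBelow (closureEmb (K := K) (hℓG.place.adicCompletion K)) 𝔐 ∈ hℓG.place.primesAbove :=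
    HeightOneSpectrum.primeBelow_mem_primesAbove h𝔐
  haveI := h𝔓.1
  -- ### the ramified value (Gross's Frobenius `F`, the inertia element `i`)
  obtain ⟨F, i, hF, hFT, hiI, hP0, hW₀Q⟩ := exists_frob_inertia_weil_ne_zero W K hK hsurj ι hc e hμ hadd₁ hadd₂ halt hnondeg
    hℓ hℓG.place hv h𝔐 s hxs hys hxK hx0 hyT hy0
  have hD : ∀ d ∈ (hℓG.place.primeBelow (closureEmb (K := K) (hℓG.place.adicCompletion K)) 𝔐).decompositionSubgroup (absoluteGaloisGroup K),
      d ∈ torsionFixing (W.baseChange K) ((3 ^ 1 : ℕ) : ℤ) := fun d hd ↦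
    decompositionSubgroup_le_torsionFixing W K hK hℓ hℓG.place hv h𝔐 hd
  have hres : ∀ g : absoluteGaloisGroup (hℓG.place.adicCompletion K), absGaloisRestrict K (hℓG.place.adicCompletion K) g ∈
      (hℓG.place.primeBelow (closureEmb (K := K) (hℓG.place.adicCompletion K)) 𝔐).decompositionSubgroup (absoluteGaloisGroup K) := fun g ↦ by
    rw [← resGal_eq_absGaloisRestrict, resGal_eq]; exact resGalOfEmb_mem_decompositionSubgroup _ h𝔐 g
  have hfixA : ∀ (g : absoluteGaloisGroup (hℓG.place.adicCompletion K)) (Q : geomTorsion (W.baseChange K) ((3 ^ 1 : ℕ) : ℤ)),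
      absGaloisRestrict K (hℓG.place.adicCompletion K) g • Q = Q := fun g Q ↦ smul_eq_of_mem_torsionFixing (W.baseChange K) _ (hD _ (hres g)) Q
  have hfixμ : ∀ (g : absoluteGaloisGroup (hℓG.place.adicCompletion K)) (z : MuCarrier K (3 ^ 1)), mu K (3 ^ 1) (absGaloisRestrict K (hℓG.place.adicCompletion K) g) z = z := by
    intro g z
    apply MuCarrier.toAdditive.injective
    rw [DiscreteGaloisModule.mu_apply_apply]
    apply Additive.toMul.injective
    rw [toMul_ofMul]
    apply Subtype.ext
    apply Units.ext
    rw [absoluteGaloisGroup.coe_smul_rootsOfUnity, Units.coe_smul]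
    have hz : ((((MuCarrier.toAdditive z).toMul : rootsOfUnity (3 ^ 1) (AlgebraicClosure K)) : (AlgebraicClosure K)ˣ) :
        AlgebraicClosure K) ^ (3 ^ 1) = 1 := by
      have := ((MuCarrier.toAdditive z).toMul).2
      rw [mem_rootsOfUnity] at this
      rw [← Units.val_pow_eq_pow_val, this, Units.val_one]
    exact smul_eq_self_of_pow_three_eq_one_of_mem_torsionFixing W K e hμ hnondeg hgal (hD _ (hres g)) hz
  obtain ⟨gF, hgF⟩ := exists_absGaloisRestrict_eq_of_mem_decompositionSubgroup K hℓG.place h𝔐 hF.mem_stabilizer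
  have hpT : ∀ Q : geomTorsion (W.baseChange K) ((3 ^ 1 : ℕ) : ℤ), 3 • Q = 0 := fun Q ↦ by
    have := (mem_geomTorsion_iff (W.baseChange K) ((3 ^ 1 : ℕ) : ℤ) _).mp Q.2
    apply Subtype.ext
    rw [AddSubgroupClass.coe_nsmul, ← natCast_zsmul]
    exact this
  have hμ3 : ∀ z : MuCarrier K (3 ^ 1), 3 • z = 0 := fun z ↦ by
    rw [← natCast_zsmul]; exact zsmul_muCarrier_eq_zero K (3 ^ 1) z
  -- ### the cocycles (global representatives `φx, φy`; local pullbacks `fx, fy` on `Γ_λ`)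
  obtain ⟨φx, hφx⟩ : ∃ φ, φ = reprCocycle (W.baseChange K) ((3 ^ 1 : ℕ) : ℤ) x := ⟨_, rfl⟩
  obtain ⟨φy, hφy⟩ : ∃ φ, φ = reprCocycle (W.baseChange K) ((3 ^ 1 : ℕ) : ℤ) y := ⟨_, rfl⟩
  have hPφ : h1Eval (W.baseChange K) ((3 ^ 1 : ℕ) : ℤ) x F = φx.1 F := by rw [hφx]; rfl
  have hyφ : ∀ d, h1Eval (W.baseChange K) ((3 ^ 1 : ℕ) : ℤ) y d = φy.1 d := fun d ↦ by rw [hφy]; rfl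
  rw [hPφ, hyφ] at hW₀Q
  rw [hPφ] at hP0
  have hP3 : addOrderOf (φx.1 F) = 3 := addOrderOf_eq_prime (hpT _) hP0
  have hxI : ∀ i ∈ (hℓG.place.primeBelow (closureEmb (K := K) (hℓG.place.adicCompletion K)) 𝔐).inertia (absoluteGaloisGroup K),
      φx.1 i = 0 := by
    have h := ((W.baseChange K).oneCocycleClass_mem_selmerLocalKer_iff hgood h3v h𝔓 φx).mp
    rw [hφx, oneCocycleClass_reprCocycle] at h
    rw [hφx]
    exact h hxK
  obtain ⟨fx, hfxdef⟩ : ∃ f : contOneCocycles ((DiscreteGaloisModule.toLocal ((W.baseChange K).torsionGaloisModule ((3 ^ 1 : ℕ) : ℤ)) (Sum.inr hℓG.place)).toTopRep),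
      f = contOneCocycles.pullback (absGaloisRestrict K (hℓG.place.adicCompletion K))
        (X := discreteTopRep (absoluteGaloisGroup K) (geomTorsion (W.baseChange K) ((3 ^ 1 : ℕ) : ℤ)))
        (Y := (DiscreteGaloisModule.toLocal ((W.baseChange K).torsionGaloisModule ((3 ^ 1 : ℕ) : ℤ)) (Sum.inr hℓG.place)).toTopRep)
        (TopRep.ofHom ⟨ContinuousLinearMap.id ℤ (geomTorsion (W.baseChange K) ((3 ^ 1 : ℕ) : ℤ)), fun _ => rfl⟩) φx :=
    ⟨_, rfl⟩
  obtain ⟨fy, hfydef⟩ : ∃ f : contOneCocycles ((DiscreteGaloisModule.toLocal ((W.baseChange K).torsionGaloisModule ((3 ^ 1 : ℕ) : ℤ)) (Sum.inr hℓG.place)).toTopRep),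
      f = contOneCocycles.pullback (absGaloisRestrict K (hℓG.place.adicCompletion K))
        (X := discreteTopRep (absoluteGaloisGroup K) (geomTorsion (W.baseChange K) ((3 ^ 1 : ℕ) : ℤ)))
        (Y := (DiscreteGaloisModule.toLocal ((W.baseChange K).torsionGaloisModule ((3 ^ 1 : ℕ) : ℤ)) (Sum.inr hℓG.place)).toTopRep)
        (TopRep.ofHom ⟨ContinuousLinearMap.id ℤ (geomTorsion (W.baseChange K) ((3 ^ 1 : ℕ) : ℤ)), fun _ => rfl⟩) φy :=
    ⟨_, rfl⟩
  have hfx : ∀ g, fx.1 g = φx.1 (absGaloisRestrict K (hℓG.place.adicCompletion K) g) := fun g ↦ by rw [hfxdef]; rfl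
  have hfy : ∀ g, fy.1 g = φy.1 (absGaloisRestrict K (hℓG.place.adicCompletion K) g) := fun g ↦ by rw [hfydef]; rfl
  have hlocx : galoisCohomology.localization ((W.baseChange K).torsionGaloisModule ((3 ^ 1 : ℕ) : ℤ)) (Sum.inr hℓG.place) 1 x =
      oneCocycleClass ((DiscreteGaloisModule.toLocal ((W.baseChange K).torsionGaloisModule ((3 ^ 1 : ℕ) : ℤ)) (Sum.inr hℓG.place)).toTopRep) fx := by
    rw [← oneCocycleClass_reprCocycle (W.baseChange K) ((3 ^ 1 : ℕ) : ℤ) x, hfxdef, hφx]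
    exact res_torsionGaloisModule_oneCocycleClass (W.baseChange K) ((3 ^ 1 : ℕ) : ℤ) (hℓG.place.adicCompletion K) _
  have hlocy : galoisCohomology.localization ((W.baseChange K).torsionGaloisModule ((3 ^ 1 : ℕ) : ℤ)) (Sum.inr hℓG.place) 1 y =
      oneCocycleClass ((DiscreteGaloisModule.toLocal ((W.baseChange K).torsionGaloisModule ((3 ^ 1 : ℕ) : ℤ)) (Sum.inr hℓG.place)).toTopRep) fy := by
    rw [← oneCocycleClass_reprCocycle (W.baseChange K) ((3 ^ 1 : ℕ) : ℤ) y, hfydef, hφy]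
    exact res_torsionGaloisModule_oneCocycleClass (W.baseChange K) ((3 ^ 1 : ℕ) : ℤ) (hℓG.place.adicCompletion K) _
  have hfx_add : ∀ g g', fx.1 (g * g') = fx.1 g + fx.1 g' := fun g g' ↦
    (fx.2 g g').trans (congrArg (fun Q ↦ fx.1 g + Q) (hfixA g (fx.1 g')))
  have hfy_add : ∀ g g', fy.1 (g * g') = fy.1 g + fy.1 g' := fun g g' ↦
    (fy.2 g g').trans (congrArg (fun Q ↦ fy.1 g + Q) (hfixA g (fy.1 g')))
  have hfx1 : fx.1 1 = 0 := by
    have h := hfx_add 1 1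
    rw [mul_one] at h
    exact left_eq_add.mp h
  have hfy1 : fy.1 1 = 0 := by
    have h := hfy_add 1 1
    rw [mul_one] at h
    exact left_eq_add.mp h
  have hfxF : fx.1 gF = φx.1 F := by rw [hfx, hgF]
  -- rank one of `fx`: `fx g = k • (φx.1 F)`
  have hrank : ∀ g, ∃ k : ℕ, fx.1 g = k • (φx.1 F) := by
    intro g
    obtain ⟨k, hk⟩ := exists_apply_eq_nsmul_apply_of_unramified K hℓG.place h𝔐 fx.1 hfx_add
      (fun g hg ↦ (hfx g).trans (hxI _ hg)) hF hgF g
    exact ⟨k, hk.trans (congrArg (fun Q ↦ k • Q) hfxF)⟩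
  obtain ⟨W₀, hW₀⟩ : ∃ W₀, W₀ = weilPairingHom (W.baseChange K) (3 ^ 1) e hμ hadd₁ hadd₂ := ⟨_, rfl⟩
  rw [← hW₀] at hW₀Q
  -- ### local Tate duality: a class `η'` of `H¹(K_λ, E[3]^D)` pairing non-trivially with `loc x`
  have hM : ∀ m : geomTorsion (W.baseChange K) ((3 ^ 1 : ℕ) : ℤ), (3 ^ 1) • m = 0 := fun m ↦ AddSubgroup.torsionBy.nsmul m
  have hinjL := ((hinvperf hℓG.place).2 ((W.baseChange K).torsionGaloisModule ((3 ^ 1 : ℕ) : ℤ)) hM).1.1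
  have hξ0 := mt (mem_torsionLocalKer_iff_localization_eq_zero W K hℓG.place x).mpr hx0
  obtain ⟨η', hη'⟩ : ∃ η', DiscreteGaloisModule.localTatePairingZMod ((W.baseChange K).torsionGaloisModule ((3 ^ 1 : ℕ) : ℤ)) (3 ^ 1) (Sum.inr hℓG.place)
      (inv (Sum.inr hℓG.place)) (galoisCohomology.localization ((W.baseChange K).torsionGaloisModule ((3 ^ 1 : ℕ) : ℤ)) (Sum.inr hℓG.place) 1 x) η' ≠ 0 := by
    by_contra hall
    push Not at hall
    exact hξ0 (hinjL ((AddMonoidHom.ext hall).trans (map_zero _).symm))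
  obtain ⟨g', rfl⟩ := oneCocycleClass_surjective _ η'
  rw [DiscreteGaloisModule.localTatePairingZMod_apply, hlocx, DiscreteGaloisModule.localTatePairing_oneCocycleClass,
    ContPairing.cupClass_eq_twoCocycleClass] at hη'
  -- ### the goal in cocycle currency
  rw [hlocx, hlocy]
  erw [ContPairing.cupProduct_oneCocycleClass]
  rw [ContPairing.cupClass_eq_twoCocycleClass]
  -- ### the characters `n, m : Γ_λ → μ₃`
  let n : C(absoluteGaloisGroup (hℓG.place.adicCompletion K), MuCarrier K (3 ^ 1)) :=
    ⟨fun τ ↦ W₀ (φx.1 F) (fy.1 τ), continuous_of_discreteTopology.comp fy.1.continuous⟩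
  let m : C(absoluteGaloisGroup (hℓG.place.adicCompletion K), MuCarrier K (3 ^ 1)) :=
    ⟨fun τ ↦ tateDualEval K _ (3 ^ 1) (φx.1 F) (g'.1 τ), continuous_of_discreteTopology.comp g'.1.continuous⟩
  have hn : ∀ τ, n τ = W₀ (φx.1 F) (fy.1 τ) := fun _ ↦ rfl
  have hm : ∀ τ, m τ = g'.1 τ (φx.1 F) := fun _ ↦ rfl
  have hn_add : ∀ τ τ', n (τ * τ') = n τ + n τ' := fun τ τ' ↦ by
    rw [hn, hn, hn]
    exact (congrArg (fun Q ↦ W₀ (φx.1 F) Q) (hfy_add τ τ')).trans (map_add _ _ _)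
  have hg'_fix : ∀ (τ : absoluteGaloisGroup (hℓG.place.adicCompletion K)) (f : TateDual K (geomTorsion (W.baseChange K) ((3 ^ 1 : ℕ) : ℤ)) (3 ^ 1))
      (Q : geomTorsion (W.baseChange K) ((3 ^ 1 : ℕ) : ℤ)),
      (((W.baseChange K).torsionGaloisModule ((3 ^ 1 : ℕ) : ℤ)).tateDual (3 ^ 1)) (absGaloisRestrict K (hℓG.place.adicCompletion K) τ) f Q = f Q := fun τ f Q ↦ by
    rw [DiscreteGaloisModule.tateDual_apply_apply_apply, hfixμ]
    congr 1
    change (absGaloisRestrict K (hℓG.place.adicCompletion K) τ)⁻¹ • Q = Q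
    rw [← map_inv]
    exact hfixA τ⁻¹ Q
  have hm_add : ∀ τ τ', m (τ * τ') = m τ + m τ' := fun τ τ' ↦
    (congrArg (fun f ↦ tateDualEval K _ (3 ^ 1) (φx.1 F) f) (g'.2 τ τ')).trans
      ((map_add (tateDualEval K _ (3 ^ 1) (φx.1 F)) _ _).trans
        (congrArg (fun t ↦ m τ + t) (hg'_fix τ (g'.1 τ') (φx.1 F))))
  -- the cocycle values
  have hc : ∀ σ τ, ((weilContPairingLocal (W.baseChange K) (3 ^ 1) e hμ hadd₁ hadd₂ hgal (Sum.inr hℓG.place)).cupCocycle fx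
      fy).1 (σ, τ) = W₀ (fx.1 σ) (fy.1 τ) := fun σ τ ↦ by
    rw [ContPairing.cupCocycle_apply_eq_smul, weilContPairingLocal_toLin_apply, hW₀]
    exact congrArg (fun Q ↦ weilPairingHom (W.baseChange K) (3 ^ 1) e hμ hadd₁ hadd₂ (fx.1 σ) Q) (hfixA σ (fy.1 τ))
  have hc' : ∀ σ τ, ((DiscreteGaloisModule.tateDualPairingLocal ((W.baseChange K).torsionGaloisModule ((3 ^ 1 : ℕ) : ℤ))
      (3 ^ 1) (Sum.inr hℓG.place)).cupCocycle fx g').1 (σ, τ) = g'.1 τ (fx.1 σ) := fun σ τ ↦ by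
    rw [ContPairing.cupCocycle_apply_eq_smul]
    exact hg'_fix σ (g'.1 τ) (fx.1 σ)
  -- ### `n` is ramified: at a lift `gi` of `i`, `n gi = ẽ((φx.1 F), [y, i]) ≠ 0`
  obtain ⟨gi, hgi⟩ := exists_absGaloisRestrict_eq_of_mem_decompositionSubgroup K hℓG.place h𝔐
    (Ideal.inertia_le_stabilizer _ hiI)
  have hram : ∃ g, absGaloisRestrict K (hℓG.place.adicCompletion K) g ∈ (hℓG.place.primeBelow (closureEmb (K := K) (hℓG.place.adicCompletion K)) 𝔐).inertia
      (absoluteGaloisGroup K) ∧ n g ≠ 0 :=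
    ⟨gi, by rw [hgi]; exact hiI, fun h0 ↦ hW₀Q ((by rw [hn, hfy, hgi] : n gi = W₀ (φx.1 F) (φy.1 i)).symm.trans h0)⟩
  -- ### the character identity and the rank-one conclusion
  have h3v' : ((3 ^ 1 : ℕ) : 𝓞 K) ∉ hℓG.place.asIdeal := by
    have := h3v; rwa [Int.cast_natCast] at this
  obtain ⟨j, w₀, hkey⟩ := exists_sub_zsmul_eq_nsmul K hℓG.place h𝔐 h3v' hℓG.valuation_natCast hF hgF fx.1 hfx_add
    (fun g hg ↦ (hfx g).trans (hxI _ hg)) ((congrArg addOrderOf hfxF).trans hP3) n m hn_add hm_add hram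
  have hc'0 : twoCocycleClass _ ((DiscreteGaloisModule.tateDualPairingLocal
      ((W.baseChange K).torsionGaloisModule ((3 ^ 1 : ℕ) : ℤ)) (3 ^ 1) (Sum.inr hℓG.place)).cupCocycle fx g') ≠ 0 :=
    fun h0 ↦ hη' (by rw [h0]; exact map_zero _)
  refine twoCocycleClass_ne_zero_of_rank_one ((DiscreteGaloisModule.toLocal (mu K (3 ^ 1)) (Sum.inr hℓG.place)).toTopRep)
    fx.1 hfx_add hP3 hpT hrank n m
    ((weilContPairingLocal (W.baseChange K) (3 ^ 1) e hμ hadd₁ hadd₂ hgal (Sum.inr hℓG.place)).cupCocycle fx fy)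
    ((DiscreteGaloisModule.tateDualPairingLocal ((W.baseChange K).torsionGaloisModule ((3 ^ 1 : ℕ) : ℤ)) (3 ^ 1)
      (Sum.inr hℓG.place)).cupCocycle fx g')
    (fun σ τ k hk ↦ ?_) (fun σ τ k hk ↦ ?_) hμ3 (fun g ↦ hfixμ g w₀)
    (fun τ k hk ↦ hkey τ k (hk.trans (congrArg (fun Q ↦ k • Q) hfxF.symm))) hc'0
  · -- `c(σ, τ) = k_σ · n(τ)`
    rw [hc]
    exact (congrArg (fun Q ↦ W₀ Q (fy.1 τ)) hk).trans (map_nsmul (W₀.flip (fy.1 τ)) k (φx.1 F))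
  · -- `c'(σ, τ) = k_σ · m(τ)`
    rw [hc']
    exact (congrArg (fun Q ↦ g'.1 τ Q) hk).trans (map_nsmul (g'.1 τ) k (φx.1 F))

end Summit.BirchSwinnertonDyer.Rank1Residual.X11b.Three.Koly.Method2.KolyLocal

end
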